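import Literature.MathematicalPhysics.QuantumFieldTheory.Balaban1983to89.B8Ineq159CurvedCubeMemberInAkVerbatim

/-!
# `Balaban1983to89.B8Ineq159CurvedCubeMemberEtaScaling` — [Balaban1985RegularSpaces] (1.59) p. 86 on the cube member: THE CONSTANTS DO NOT DEPEND ON THE
# LATTICE SPACING `η`.  The `η`-homogeneity of (1.1)∕(1.2)∕(1.38)∕(1.55) ((1.8): «|U(∂p) − 1| < α₀η²(Lʲη)^{−2}», the thresholds do not involve `η`) makes the
# per-member curved (1.59) at `𝔄_k({□_j}, α₀)` uniform in `η > 0`: ONE `α₀(□)`, ONE `B″(□)` for all lattice spacings (rescaling `A ↦ ηA`)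

statement-level skeleton of published theorems with citation tags; proofs where landed; nothing here is a claim about the
Yang–Mills mass gap

`[Balaban1985RegularSpaces]` ("B8", CMP **99** (1985) 75–102) (1.1)–(1.2) p. 76, (1.7)–(1.8) p. 77, (1.38) p. 82, (1.55) p. 86, (1.59) p. 86, (1.62) p. 87, p. 83
(«Let us rescale the expressions from `T_η` to `T₁`»); [4] = `[Balaban1985BackgroundPropagators]` (3.4) p. 391, (3.19) p. 393, (3.23)–(3.25) p. 394.

CITATION HEADER (lean-in-tree rule).  Cell `pub-ymgap` (YM Track A, HUMAN RULING D-0062 ∕ D-0149), DAG node N05 = [B8], width seat `pub-ymgap-dag-n05-w3`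
(g3), CLAIM-1 file (S).  WHY.  The per-member constants of this seat's curved (1.59) (files (D)–(H), (V)) are produced member by member, the member datum
including `η`; g2's ■ line listed «η-independence of the per-member constants» as open.  Print's estimates are scale-free (p. 83 rescales `T_η → T₁`); THIS
FILE makes that rescaling explicit for every datum and target of the member's (1.59) and derives the `η`-UNIFORM statements from the `η = 1` case of file (V).

THE MATHEMATICS (kernel-checked).  §1 the homogeneity identities under `A ↦ ηA` (`η ≠ 0`): `covDerivFwd_one_smul` (`D¹_{U₀}(ηf) = η²·D^η_{U₀}f`), `covDeriv_one_smul`,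
`covDivB_one_smul` (`η²`), `covLap_one_smul` (`η³`), `covLap_one_real_smul` (ℝ-linearity at `η = 1`), `plaqCovDeriv_one_smul` (`η²`), `Jcur_one_smul` (`η³`),
`iEta_one_smul` (`i·1·(ηA) = iηA`), private `QprimeT_smul_real` ∕ `QT_smul_real` (ℝ-homogeneity of (3.19)∕(3.24) in the multiplier — the ℂ-form is
`B9Eq321LandauMultiplierIffZd.QT_smul`, not imported here), ★ `isLandau138_one_smul` ((1.38) at spacing `η` for `A` ⟹ (1.38) at spacing `1` for `ηA`,
multiplier `η⁴μ`); §2 ★★★ `exists_curved159_perCube_touching_uniformEta` (m = 1, `U1`) and ★★★ `exists_curved159_perCube_inAk_verbatim_uniformEta`: the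
theorems of file (V) with `∃ α₀ B″` BEFORE `∀ η > 0`; §3 the all-truncations twins `…_tower_uniformEta`, `…_inAk_verbatim_tower_uniformEta` (averaging-closed
`G`, `2 ≤ L`) and `…_unitary_uniformEta`.  PROOF of §2–§3: apply the `η = 1` statement to `ψ := ηφ`; every hypothesis and target at `(η, φ)` equals the
corresponding one at `(1, ψ)` by §1.

HONEST SCOPE ∕ A6.  PER MEMBER still in `(a, M, ρ, k)` and `𝔸` (NOT print's uniform `α₀`, `B₀(d, L)` = [4] Thm 3.3 = the N06 object layer); uniform in `η` only;
member-dependent powers of `L` in the derivative targets as in (V).  Non-vacuity: `U₀ = 1`, `φ = 0`.  Count-neutral; N05 NOT discharged; no count claim; one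
finite `𝕋⁴` programme at fixed `ε`, Bałaban as printed; the YM mass gap (Clay) is NOT proved by any of this — R4 closes the conditional finite-`𝕋⁴` rung
`BalabanLadder.UV` only; nothing continuum ∕ ℝ⁴ ∕ OS.  No `sorry`, no `def`, no `instance`, no `notation`.  Unit `pub-ymgap-dag-n05-w3` (g3), 2026-08-28.
-/

noncomputable section

namespace Literature.MathematicalPhysics.QuantumFieldTheory.Balaban1983to89.B8Ineq159CurvedCubeMemberEtaScaling

open B7Prop1Explicit B7Prop2Explicit B7Prop1Local
open B7Eq78Linearization (conjR conjR_apply conjR_smul conjR_smul_real)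
open B7Prop4GeneralLevels (linCovIter)
open B8Ineq132 (covDerivFwd covDeriv BondTouches PlaqTouches plaqF InAk)
open B8Eq140Level (SideTouches)
open B8Eq143PlaqExpansion (pdiv)
open B8Eq146AExpansion (iEta plaqCovDeriv plaqCovDeriv_eq_covDerivFwd)
open B8Eq155JBound (Jcur)
open B8Eq138LandauZd (IsLandau138 covLap covDivB qprimeT1 QprimeT QT)
open B8Eq131Cubes (sqLo sqHi)
open B8Eq131CubesAdmissible (cubeFam)
open B8CubeMemberZd (cubeLamS)
open B8Ineq159FlatCubeMemberPrinted (cubeLamBP)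
open B8Ineq159CurvedCubeMemberInAkVerbatim (exists_curved159_perCube_touching exists_curved159_perCube_touching_tower)

-- `Site` alone would resolve to the torus sites of `Setup.lean`; re-export the `ℤ^d` sites of `B7Prop1Explicit`.
export B7Prop1Explicit (Site)

variable {d : ℕ} {𝔸 : Type*} [NormedRing 𝔸] [NormOneClass 𝔸] [NormedAlgebra ℂ 𝔸] [CompleteSpace 𝔸]

/-! ## §1 Homogeneity of the stencils under `A ↦ ηA` -/

section Homogeneity

variable {η : ℝ} (U₀ : Site d → Fin d → 𝔸ˣ)

omit [NormOneClass 𝔸] [CompleteSpace 𝔸] in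
/-- **`D¹_{U₀,ν}(ηf) = η²·D^η_{U₀,ν}f`** ((1.1): `D^η = η⁻¹(R(U)f(· + e) − f)`). [cite: Balaban1985RegularSpaces, (1.1) p.76, p.83 (rescaling T_η → T₁)] -/
theorem covDerivFwd_one_smul (hη : η ≠ 0) (ν : Fin d) (f : Site d → 𝔸) (x : Site d) :
    covDerivFwd 1 U₀ ν (fun z => η • f z) x = η ^ 2 • covDerivFwd η U₀ ν f x := by
  simp only [covDerivFwd, inv_one, conjR_smul_real, ← smul_sub, smul_smul]
  congr 1
  field_simp

omit [NormOneClass 𝔸] [CompleteSpace 𝔸] in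
/-- **`D^{1*}_{U₀,ν}(ηf) = η²·D^{η*}_{U₀,ν}f`** ((1.1), second line). [cite: Balaban1985RegularSpaces, (1.1) p.76, p.83] -/
theorem covDeriv_one_smul (hη : η ≠ 0) (ν : Fin d) (f : Site d → 𝔸) (x : Site d) :
    covDeriv 1 U₀ ν (fun z => η • f z) x = η ^ 2 • covDeriv η U₀ ν f x := by
  simp only [covDeriv, inv_one, conjR_smul_real, ← smul_sub, smul_smul]
  congr 1
  field_simp

omit [NormOneClass 𝔸] [CompleteSpace 𝔸] in
/-- ℝ-linearity of the backward derivative at spacing `1`. [cite: Balaban1985RegularSpaces, (1.1) p.76] -/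
theorem covDeriv_one_real_smul (c : ℝ) (ν : Fin d) (f : Site d → 𝔸) (x : Site d) :
    covDeriv 1 U₀ ν (fun z => c • f z) x = c • covDeriv 1 U₀ ν f x := by
  simp only [covDeriv, inv_one, one_smul, conjR_smul_real, ← smul_sub]

omit [NormOneClass 𝔸] [CompleteSpace 𝔸] in
/-- **`D^{1*}_{U₀}(ηA) = η²·D^{η*}_{U₀}A`** (the divergence of (1.38)). [cite: Balaban1985RegularSpaces, (1.38) p.82, (1.1) p.76, p.83] -/
theorem covDivB_one_smul (hη : η ≠ 0) (A : Site d → Fin d → 𝔸) (x : Site d) :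
    covDivB 1 U₀ (fun z μ => η • A z μ) x = η ^ 2 • covDivB η U₀ A x := by
  unfold covDivB
  rw [Finset.smul_sum]
  exact Finset.sum_congr rfl fun μ _ => covDeriv_one_smul U₀ hη μ (fun z => A z μ) x

omit [NormOneClass 𝔸] [CompleteSpace 𝔸] in
/-- ℝ-linearity of the Laplacian (3.23) at spacing `1`. [cite: Balaban1985BackgroundPropagators, (3.23) p.394] -/
theorem covLap_one_real_smul (c : ℝ) (f : Site d → 𝔸) (x : Site d) :
    covLap 1 U₀ (fun z => c • f z) x = c • covLap 1 U₀ f x := by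
  unfold covLap covDivB
  rw [Finset.smul_sum]
  refine Finset.sum_congr rfl fun μ _ => ?_
  have h1 : (fun z => covDerivFwd 1 U₀ μ (fun w => c • f w) z) = fun z => c • covDerivFwd 1 U₀ μ f z := by
    funext z
    simp only [covDerivFwd, inv_one, one_smul, conjR_smul_real, ← smul_sub]
  rw [h1, covDeriv_one_real_smul]

omit [NormOneClass 𝔸] [CompleteSpace 𝔸] in
/-- **`Δ¹_{U₀}g = η²·Δ^η_{U₀}g`** ((3.23) is homogeneous of degree `−2` in the spacing). [cite: Balaban1985BackgroundPropagators, (3.23) p.394; Balaban1985RegularSpaces, p.83] -/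
theorem covLap_one_eq (hη : η ≠ 0) (g : Site d → 𝔸) (x : Site d) : covLap 1 U₀ g x = η ^ 2 • covLap η U₀ g x := by
  unfold covLap covDivB
  rw [Finset.smul_sum]
  refine Finset.sum_congr rfl fun μ _ => ?_
  have h1 : (fun z => covDerivFwd 1 U₀ μ g z) = fun z => η • covDerivFwd η U₀ μ g z := by
    funext z
    simp only [covDerivFwd, inv_one, one_smul, smul_smul, mul_inv_cancel₀ hη]
  rw [h1]
  simp only [covDeriv, inv_one, conjR_smul_real, ← smul_sub, smul_smul]
  congr 1
  field_simp

omit [NormOneClass 𝔸] [CompleteSpace 𝔸] in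
/-- **`Δ¹_{U₀}(ηf) = η³·Δ^η_{U₀}f`**. [cite: Balaban1985BackgroundPropagators, (3.23) p.394; Balaban1985RegularSpaces, p.83] -/
theorem covLap_one_smul (hη : η ≠ 0) (f : Site d → 𝔸) (x : Site d) :
    covLap 1 U₀ (fun z => η • f z) x = η ^ 3 • covLap η U₀ f x := by
  rw [covLap_one_real_smul, covLap_one_eq U₀ hη, smul_smul]
  congr 1
  ring

omit [NormOneClass 𝔸] [CompleteSpace 𝔸] in
/-- **The plaquette derivative (3.4): `(D¹_{U₀}(ηA))(p) = η²·(D^η_{U₀}A)(p)`**. [cite: Balaban1985BackgroundPropagators, (3.4) p.391; Balaban1985RegularSpaces, p.83] -/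
theorem plaqCovDeriv_one_smul (hη : η ≠ 0) (A : Site d → Fin d → 𝔸) (μ ν : Fin d) (x : Site d) :
    plaqCovDeriv 1 U₀ (fun z κ => η • A z κ) μ ν x = η ^ 2 • plaqCovDeriv η U₀ A μ ν x := by
  rw [plaqCovDeriv_eq_covDerivFwd, plaqCovDeriv_eq_covDerivFwd, smul_sub,
    ← covDerivFwd_one_smul U₀ hη μ (fun y => A y ν) x, ← covDerivFwd_one_smul U₀ hη ν (fun y => A y μ) x]

omit [NormOneClass 𝔸] [CompleteSpace 𝔸] in
/-- **The current (1.55): `J¹_{U₀}(ηA) = η³·J^η_{U₀}(A)`** (`J = D^{η*}_{U₀}D^η_{U₀}A` is homogeneous of degree `−2` and linear).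
[cite: Balaban1985RegularSpaces, (1.55) p.86, (1.1)–(1.2) p.76, p.83] -/
theorem Jcur_one_smul (hη : η ≠ 0) (A : Site d → Fin d → 𝔸) (μ : Fin d) (x : Site d) :
    Jcur 1 U₀ (fun z κ => η • A z κ) μ x = η ^ 3 • Jcur η U₀ A μ x := by
  have hF : plaqCovDeriv 1 U₀ (fun z κ => η • A z κ) = fun κ κ' z => η ^ 2 • plaqCovDeriv η U₀ A κ κ' z := by
    funext κ κ' z; exact plaqCovDeriv_one_smul U₀ hη A κ κ' z
  have hterm : ∀ (ν : Fin d) (F : Site d → 𝔸), covDeriv 1 U₀ ν (fun z => η ^ 2 • F z) x = η ^ 3 • covDeriv η U₀ ν F x := by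
    intro ν F
    simp only [covDeriv, inv_one, conjR_smul_real, ← smul_sub, smul_smul]
    congr 1
    field_simp
  rw [B8Eq155JBound.Jcur_def, B8Eq155JBound.Jcur_def, hF]
  unfold pdiv
  rw [smul_sub, Finset.smul_sum, Finset.smul_sum]
  congr 1
  · exact Finset.sum_congr rfl fun ν _ => hterm ν _
  · exact Finset.sum_congr rfl fun ν _ => hterm ν _

omit [NormOneClass 𝔸] [CompleteSpace 𝔸] in
/-- `i·1·(ηA) = iηA` (the exponent field of (1.36) rescaled). [cite: Balaban1985RegularSpaces, (1.36) p.82, p.83] -/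
theorem iEta_one_smul (η : ℝ) (A : Site d → Fin d → 𝔸) : iEta 1 (fun z κ => η • A z κ) = iEta η A := by
  funext z κ
  simp only [B8Eq146AExpansion.iEta_def, Complex.ofReal_one, mul_one, ← Complex.coe_smul, smul_smul]

omit [NormOneClass 𝔸] in
/-- ℝ-homogeneity of `Q′_j(U₀)ᵀ` in its argument (the ℂ-form is `B9Eq321LandauMultiplierIffZd.QprimeT_smul`). [cite: Balaban1985BackgroundPropagators, (3.19) p.393] -/
private theorem QprimeT_smul_real (L : ℕ) (c : ℝ) : ∀ (j : ℕ) (g : Site d → 𝔸) (x : Site d),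
    QprimeT L U₀ j (fun y => c • g y) x = c • QprimeT L U₀ j g x
  | 0, _, _ => rfl
  | j + 1, g, x => by
    show QprimeT L U₀ j (qprimeT1 L U₀ j fun y => c • g y) x = c • QprimeT L U₀ j (qprimeT1 L U₀ j g) x
    have h1 : (qprimeT1 L U₀ j fun y => c • g y) = fun y => c • qprimeT1 L U₀ j g y := by
      funext y
      simp only [qprimeT1, conjR_smul_real]
      exact smul_comm _ _ _
    rw [h1, QprimeT_smul_real L c j]

omit [NormOneClass 𝔸] in
/-- ℝ-homogeneity of `Q′(U₀)ᵀμ` ((3.24)) in the multiplier (the ℂ-form is `B9Eq321LandauMultiplierIffZd.QT_smul`).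
[cite: Balaban1985BackgroundPropagators, (3.24) p.394] -/
private theorem QT_smul_real (L m : ℕ) (Λs : ℕ → Set (Site d)) (c : ℝ) (μ : ℕ → Site d → 𝔸) (x : Site d) :
    QT L m Λs U₀ (fun j y => c • μ j y) x = c • QT L m Λs U₀ μ x := by
  classical
  simp only [QT, Finset.smul_sum]
  refine Finset.sum_congr rfl fun j _ => ?_
  have hind : (Λs j).indicator (fun y => c • μ j y) = fun y => c • (Λs j).indicator (μ j) y :=
    Set.indicator_const_smul (Λs j) c (μ j)
  rw [hind, QprimeT_smul_real U₀ L c j]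

omit [NormOneClass 𝔸] in
/-- ★ **(1.38) IS SCALE-FREE**: if `A` is in the curved Landau gauge (multiplier form `IsLandau138 L m η Ω₀ Λs U₀ A`) at spacing `η ≠ 0`, then `ηA` is in it at
spacing `1` (multiplier `η⁴μ`: the stencil `Δ_{U₀}(𝟙_{Ω₀}D^*_{U₀}·)` is homogeneous of degree `−4+1` under `(η, A) ↦ (1, ηA)`, the transpose `Q′(U₀)ᵀ` is linear).
[cite: Balaban1985RegularSpaces, (1.38) p.82, p.83; Balaban1985BackgroundPropagators, (3.23)–(3.25) p.394] -/
theorem isLandau138_one_smul {L m : ℕ} (hη : η ≠ 0) {Ω₀ : Set (Site d)} {Λs : ℕ → Set (Site d)} {A : Site d → Fin d → 𝔸}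
    (h : IsLandau138 L m η Ω₀ Λs U₀ A) : IsLandau138 L m 1 Ω₀ Λs U₀ (fun z κ => η • A z κ) := by
  classical
  obtain ⟨μ, hμ⟩ := h
  refine ⟨fun j y => η ^ 4 • μ j y, fun x hx => ?_⟩
  have hdiv : covDivB 1 U₀ (fun z κ => η • A z κ) = fun z => η ^ 2 • covDivB η U₀ A z := funext (covDivB_one_smul U₀ hη A)
  rw [hdiv, Set.indicator_const_smul Ω₀ (η ^ 2) (covDivB η U₀ A), covLap_one_real_smul, covLap_one_eq U₀ hη, hμ x hx, smul_smul,
    QT_smul_real]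
  congr 1
  ring

end Homogeneity

/-! ## §2 Truncation `1`: the constants are uniform in the lattice spacing -/

section TruncOne

set_option maxHeartbeats 400000 in
-- one long bookkeeping proof (five hypothesis∕target conversions under the rescaling); twice the default budget, no heavy automation
/-- ★★★ **(1.59) ON THE CUBE MEMBER FOR BACKGROUNDS WITH SMALL TOUCHING PLAQUETTES — `η`-UNIFORM CONSTANTS, TRUNCATION `1`.**  For `d ≥ 2`, `1 ≤ L ≤ ρ`,
`k ≥ 1` and `𝔸` finite-dimensional there are `α₀(□) > 0`, `B″(□) > 0` (depending on `(a, M, ρ, k)` and `𝔸`, NOT on `η`) such that FOR EVERY `η > 0` the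
statement of `B8Ineq159CurvedCubeMemberInAkVerbatim.exists_curved159_perCube_touching` holds with these constants.  PROOF: its `η = 1` case applied to
`ψ := ηφ` (§1: the Landau condition, the support clause, the three data and the three targets at `(η, φ)` are those at `(1, ψ)`).
[cite: Balaban1985RegularSpaces, (1.59) p.86, (1.62) p.87, (1.8) p.77, p.83, p.77, (1.38) p.82; Balaban1985BackgroundPropagators, Thm 3.3 p.399] -/
theorem exists_curved159_perCube_touching_uniformEta [FiniteDimensional ℂ 𝔸] (hd2 : 2 ≤ d) {L : ℕ} (hL : 1 ≤ L)
    (a : Site d) (M : ℕ) {ρ : ℕ} (hρ : L ≤ ρ) {k : ℕ} (hk : 1 ≤ k) :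
    ∃ α₀ B'' : ℝ, 0 < α₀ ∧ 0 < B'' ∧ ∀ (η : ℝ), 0 < η → ∀ (U₀ : Site d → Fin d → 𝔸ˣ), (∀ x κ, U₀ x κ ∈ U1 𝔸) →
      (∀ (z : Site d) (κ μ : Fin d), κ ≠ μ → PlaqTouches (cubeFam false L a M ρ k 0) z κ μ → ‖plaqF U₀ κ μ z - 1‖ ≤ α₀) →
      ∀ φ : Site d → Fin d → 𝔸,
        IsLandau138 L 1 η (cubeFam false L a M ρ k 0) (cubeLamS L a M ρ k 1) U₀ φ →
        (∀ (y : Site d) (τ : Fin d), (∀ j, j ≤ 1 → ¬ SideTouches (cubeFam false L a M ρ k j) y τ) → φ y τ = 0) →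
        ∀ N : ℝ, 0 ≤ N →
          (∀ j, j ≤ 1 → ∀ (y : Site d) (τ : Fin d), BondTouches (cubeFam false L a M ρ k j) y τ →
              ((L : ℝ) ^ j * η) ^ 3 * ‖Jcur η U₀ φ τ y‖ ≤ N) →
          (∀ j, j ≤ 1 → ∀ c ∈ cubeLamBP L a M ρ k 1 j, ‖linCovIter L U₀ (iEta η φ) j c.1 c.2‖ ≤ N) →
          (∀ (y : Site d) (τ : Fin d), ¬ BondTouches (cubeFam false L a M ρ k 0) y τ → η * ‖φ y τ‖ ≤ N) →
          ∀ j, j ≤ 1 → ∀ (y : Site d) (τ : Fin d), SideTouches (cubeFam false L a M ρ k j) y τ →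
            ((L : ℝ) ^ j * η) * ‖φ y τ‖ ≤ B'' * N ∧
            (∀ ν : Fin d, ((L : ℝ) ^ j * η) ^ 2 * ‖covDerivFwd η U₀ ν (fun z => φ z τ) y‖ ≤ B'' * N) ∧
            ((L : ℝ) ^ j * η) ^ 3 * ‖covLap η U₀ (fun z => φ z τ) y‖ ≤ B'' * N := by
  obtain ⟨α₀, B'', hα₀, hB'', H⟩ := exists_curved159_perCube_touching (𝔸 := 𝔸) hd2 hL one_pos a M hρ hk
  refine ⟨α₀, B'', hα₀, hB'', ?_⟩
  intro η hη U₀ hU hP φ hLan hs N hN h1 h2 h3 j hj y τ hst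
  have hη0 : η ≠ 0 := hη.ne'
  have hnη : ‖η‖ = η := by rw [Real.norm_eq_abs, abs_of_pos hη]
  -- the rescaled field `ψ = ηφ`
  set ψ : Site d → Fin d → 𝔸 := fun z κ => η • φ z κ with hψ
  have hnψ : ∀ z κ, ‖ψ z κ‖ = η * ‖φ z κ‖ := fun z κ => by rw [hψ]; dsimp only; rw [norm_smul, hnη]
  have hLanψ : IsLandau138 L 1 1 (cubeFam false L a M ρ k 0) (cubeLamS L a M ρ k 1) U₀ ψ := isLandau138_one_smul U₀ hη0 hLan
  have hsψ : ∀ (y : Site d) (τ : Fin d), (∀ j, j ≤ 1 → ¬ SideTouches (cubeFam false L a M ρ k j) y τ) → ψ y τ = 0 :=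
    fun y' τ' h => by rw [hψ]; dsimp only; rw [hs y' τ' h, smul_zero]
  have h1ψ : ∀ j, j ≤ 1 → ∀ (y : Site d) (τ : Fin d), BondTouches (cubeFam false L a M ρ k j) y τ →
      ((L : ℝ) ^ j * 1) ^ 3 * ‖Jcur 1 U₀ ψ τ y‖ ≤ N := by
    intro j' hj' y' τ' hbt
    have e : ((L : ℝ) ^ j' * 1) ^ 3 * ‖Jcur 1 U₀ ψ τ' y'‖ = ((L : ℝ) ^ j' * η) ^ 3 * ‖Jcur η U₀ φ τ' y'‖ := by
      rw [hψ, Jcur_one_smul U₀ hη0, norm_smul, norm_pow, hnη]; ring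
    rw [e]; exact h1 j' hj' y' τ' hbt
  have h2ψ : ∀ j, j ≤ 1 → ∀ c ∈ cubeLamBP L a M ρ k 1 j, ‖linCovIter L U₀ (iEta 1 ψ) j c.1 c.2‖ ≤ N := by
    intro j' hj' c hc; rw [hψ, iEta_one_smul]; exact h2 j' hj' c hc
  have h3ψ : ∀ (y : Site d) (τ : Fin d), ¬ BondTouches (cubeFam false L a M ρ k 0) y τ → 1 * ‖ψ y τ‖ ≤ N :=
    fun y' τ' h => by rw [one_mul, hnψ]; exact h3 y' τ' h
  obtain ⟨t1, t2, t3⟩ := H U₀ hU hP ψ hLanψ hsψ N hN h1ψ h2ψ h3ψ j hj y τ hst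
  refine ⟨?_, fun ν => ?_, ?_⟩
  · have e : ((L : ℝ) ^ j * η) * ‖φ y τ‖ = ((L : ℝ) ^ j * 1) * ‖ψ y τ‖ := by rw [hnψ]; ring
    rw [e]; exact t1
  · have e : ((L : ℝ) ^ j * η) ^ 2 * ‖covDerivFwd η U₀ ν (fun z => φ z τ) y‖ =
        ((L : ℝ) ^ j * 1) ^ 2 * ‖covDerivFwd 1 U₀ ν (fun z => ψ z τ) y‖ := by
      rw [hψ]; dsimp only
      rw [covDerivFwd_one_smul U₀ hη0, norm_smul, norm_pow, hnη]; ring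
    rw [e]; exact t2 ν
  · have e : ((L : ℝ) ^ j * η) ^ 3 * ‖covLap η U₀ (fun z => φ z τ) y‖ = ((L : ℝ) ^ j * 1) ^ 3 * ‖covLap 1 U₀ (fun z => ψ z τ) y‖ := by
      rw [hψ]; dsimp only
      rw [covLap_one_smul U₀ hη0, norm_smul, norm_pow, hnη]; ring
    rw [e]; exact t3

/-- ★★★ **(1.59) «FOR `U₀ ∈ 𝔄_k({□_j}, α₀)`» AT THE MEMBER'S OWN DOMAIN SEQUENCE — `η`-UNIFORM CONSTANTS, TRUNCATION `1`**: `∃ α₀ B″` BEFORE `∀ η > 0` in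
`B8Ineq159CurvedCubeMemberInAkVerbatim.exists_curved159_perCube_inAk_verbatim` ((1.7)'s thresholds do not involve `η`, (1.8)).
[cite: Balaban1985RegularSpaces, (1.59) p.86, (1.7)–(1.8) p.77, p.83; Balaban1985BackgroundPropagators, Thm 3.3 p.399] -/
theorem exists_curved159_perCube_inAk_verbatim_uniformEta [FiniteDimensional ℂ 𝔸] (hd2 : 2 ≤ d) {L : ℕ} (hL : 1 ≤ L)
    (a : Site d) (M : ℕ) {ρ : ℕ} (hρ : L ≤ ρ) {k : ℕ} (hk : 1 ≤ k) :
    ∃ α₀ B'' : ℝ, 0 < α₀ ∧ 0 < B'' ∧ ∀ (η : ℝ), 0 < η → ∀ (U₀ : Site d → Fin d → 𝔸ˣ), (∀ x κ, U₀ x κ ∈ U1 𝔸) →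
      ∀ k' : ℕ, InAk L k' η α₀ (cubeFam false L a M ρ k) U₀ →
      ∀ φ : Site d → Fin d → 𝔸,
        IsLandau138 L 1 η (cubeFam false L a M ρ k 0) (cubeLamS L a M ρ k 1) U₀ φ →
        (∀ (y : Site d) (τ : Fin d), (∀ j, j ≤ 1 → ¬ SideTouches (cubeFam false L a M ρ k j) y τ) → φ y τ = 0) →
        ∀ N : ℝ, 0 ≤ N →
          (∀ j, j ≤ 1 → ∀ (y : Site d) (τ : Fin d), BondTouches (cubeFam false L a M ρ k j) y τ →
              ((L : ℝ) ^ j * η) ^ 3 * ‖Jcur η U₀ φ τ y‖ ≤ N) →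
          (∀ j, j ≤ 1 → ∀ c ∈ cubeLamBP L a M ρ k 1 j, ‖linCovIter L U₀ (iEta η φ) j c.1 c.2‖ ≤ N) →
          (∀ (y : Site d) (τ : Fin d), ¬ BondTouches (cubeFam false L a M ρ k 0) y τ → η * ‖φ y τ‖ ≤ N) →
          ∀ j, j ≤ 1 → ∀ (y : Site d) (τ : Fin d), SideTouches (cubeFam false L a M ρ k j) y τ →
            ((L : ℝ) ^ j * η) * ‖φ y τ‖ ≤ B'' * N ∧
            (∀ ν : Fin d, ((L : ℝ) ^ j * η) ^ 2 * ‖covDerivFwd η U₀ ν (fun z => φ z τ) y‖ ≤ B'' * N) ∧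
            ((L : ℝ) ^ j * η) ^ 3 * ‖covLap η U₀ (fun z => φ z τ) y‖ ≤ B'' * N := by
  obtain ⟨α₀, B'', hα₀, hB'', H⟩ := exists_curved159_perCube_touching_uniformEta (𝔸 := 𝔸) hd2 hL a M hρ hk
  refine ⟨α₀, B'', hα₀, hB'', fun η hη U₀ hU k' hAk => H η hη U₀ hU fun z κ μ hκμ hpt => ?_⟩
  have h1 := (hAk 0 (Nat.zero_le _)).1 z κ μ hκμ hpt
  simp only [pow_zero, inv_one, one_pow, mul_one] at h1
  exact h1.le

end TruncOne

/-! ## §3 All truncations: the constants are uniform in the lattice spacing -/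

section Tower

set_option maxHeartbeats 400000 in
-- one long bookkeeping proof (five hypothesis∕target conversions under the rescaling); twice the default budget, no heavy automation
/-- ★★★ **ALL TRUNCATIONS `1 ≤ m ≤ k` — `η`-UNIFORM CONSTANTS** (`2 ≤ L ≤ ρ`, `G` averaging-closed): `∃ α₀ B″` BEFORE `∀ η > 0` in
`B8Ineq159CurvedCubeMemberInAkVerbatim.exists_curved159_perCube_touching_tower` (same rescaling `ψ = ηφ`).
[cite: Balaban1985RegularSpaces, (1.59) p.86, (1.62) p.87, (1.8) p.77, p.83; Balaban1985Averaging, Prop. 2 (52)–(54) p.26; Balaban1985BackgroundPropagators, Thm 3.3 p.399] -/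
theorem exists_curved159_perCube_touching_tower_uniformEta [FiniteDimensional ℂ 𝔸] (hd2 : 2 ≤ d) {L : ℕ} (hL2 : 2 ≤ L)
    {G : Subgroup 𝔸ˣ} (hG : AvgClosed d L G) (a : Site d) (M : ℕ) {ρ : ℕ} (hρ : L ≤ ρ) {k m : ℕ} (hm1 : 1 ≤ m) (hmk : m ≤ k) :
    ∃ α₀ B'' : ℝ, 0 < α₀ ∧ 0 < B'' ∧ ∀ (η : ℝ), 0 < η → ∀ (U₀ : Site d → Fin d → 𝔸ˣ), (∀ x κ, U₀ x κ ∈ G) →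
      (∀ (z : Site d) (κ μ : Fin d), κ ≠ μ → PlaqTouches (cubeFam false L a M ρ k 0) z κ μ → ‖plaqF U₀ κ μ z - 1‖ ≤ α₀) →
      ∀ φ : Site d → Fin d → 𝔸,
        IsLandau138 L m η (cubeFam false L a M ρ k 0) (cubeLamS L a M ρ k m) U₀ φ →
        (∀ (y : Site d) (τ : Fin d), (∀ j, j ≤ m → ¬ SideTouches (cubeFam false L a M ρ k j) y τ) → φ y τ = 0) →
        ∀ N : ℝ, 0 ≤ N →
          (∀ j, j ≤ m → ∀ (y : Site d) (τ : Fin d), BondTouches (cubeFam false L a M ρ k j) y τ →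
              ((L : ℝ) ^ j * η) ^ 3 * ‖Jcur η U₀ φ τ y‖ ≤ N) →
          (∀ j, j ≤ m → ∀ c ∈ cubeLamBP L a M ρ k m j, ‖linCovIter L U₀ (iEta η φ) j c.1 c.2‖ ≤ N) →
          (∀ (y : Site d) (τ : Fin d), ¬ BondTouches (cubeFam false L a M ρ k 0) y τ → η * ‖φ y τ‖ ≤ N) →
          ∀ j, j ≤ m → ∀ (y : Site d) (τ : Fin d), SideTouches (cubeFam false L a M ρ k j) y τ →
            ((L : ℝ) ^ j * η) * ‖φ y τ‖ ≤ B'' * N ∧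
            (∀ ν : Fin d, ((L : ℝ) ^ j * η) ^ 2 * ‖covDerivFwd η U₀ ν (fun z => φ z τ) y‖ ≤ B'' * N) ∧
            ((L : ℝ) ^ j * η) ^ 3 * ‖covLap η U₀ (fun z => φ z τ) y‖ ≤ B'' * N := by
  obtain ⟨α₀, B'', hα₀, hB'', H⟩ := exists_curved159_perCube_touching_tower (𝔸 := 𝔸) hd2 hL2 one_pos hG a M hρ hm1 hmk
  refine ⟨α₀, B'', hα₀, hB'', ?_⟩
  intro η hη U₀ hU hP φ hLan hs N hN h1 h2 h3 j hj y τ hst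
  have hη0 : η ≠ 0 := hη.ne'
  have hnη : ‖η‖ = η := by rw [Real.norm_eq_abs, abs_of_pos hη]
  set ψ : Site d → Fin d → 𝔸 := fun z κ => η • φ z κ with hψ
  have hnψ : ∀ z κ, ‖ψ z κ‖ = η * ‖φ z κ‖ := fun z κ => by rw [hψ]; dsimp only; rw [norm_smul, hnη]
  have hLanψ : IsLandau138 L m 1 (cubeFam false L a M ρ k 0) (cubeLamS L a M ρ k m) U₀ ψ := isLandau138_one_smul U₀ hη0 hLan
  have hsψ : ∀ (y : Site d) (τ : Fin d), (∀ j, j ≤ m → ¬ SideTouches (cubeFam false L a M ρ k j) y τ) → ψ y τ = 0 :=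
    fun y' τ' h => by rw [hψ]; dsimp only; rw [hs y' τ' h, smul_zero]
  have h1ψ : ∀ j, j ≤ m → ∀ (y : Site d) (τ : Fin d), BondTouches (cubeFam false L a M ρ k j) y τ →
      ((L : ℝ) ^ j * 1) ^ 3 * ‖Jcur 1 U₀ ψ τ y‖ ≤ N := by
    intro j' hj' y' τ' hbt
    have e : ((L : ℝ) ^ j' * 1) ^ 3 * ‖Jcur 1 U₀ ψ τ' y'‖ = ((L : ℝ) ^ j' * η) ^ 3 * ‖Jcur η U₀ φ τ' y'‖ := by
      rw [hψ, Jcur_one_smul U₀ hη0, norm_smul, norm_pow, hnη]; ring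
    rw [e]; exact h1 j' hj' y' τ' hbt
  have h2ψ : ∀ j, j ≤ m → ∀ c ∈ cubeLamBP L a M ρ k m j, ‖linCovIter L U₀ (iEta 1 ψ) j c.1 c.2‖ ≤ N := by
    intro j' hj' c hc; rw [hψ, iEta_one_smul]; exact h2 j' hj' c hc
  have h3ψ : ∀ (y : Site d) (τ : Fin d), ¬ BondTouches (cubeFam false L a M ρ k 0) y τ → 1 * ‖ψ y τ‖ ≤ N :=
    fun y' τ' h => by rw [one_mul, hnψ]; exact h3 y' τ' h
  obtain ⟨t1, t2, t3⟩ := H U₀ hU hP ψ hLanψ hsψ N hN h1ψ h2ψ h3ψ j hj y τ hst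
  refine ⟨?_, fun ν => ?_, ?_⟩
  · have e : ((L : ℝ) ^ j * η) * ‖φ y τ‖ = ((L : ℝ) ^ j * 1) * ‖ψ y τ‖ := by rw [hnψ]; ring
    rw [e]; exact t1
  · have e : ((L : ℝ) ^ j * η) ^ 2 * ‖covDerivFwd η U₀ ν (fun z => φ z τ) y‖ =
        ((L : ℝ) ^ j * 1) ^ 2 * ‖covDerivFwd 1 U₀ ν (fun z => ψ z τ) y‖ := by
      rw [hψ]; dsimp only
      rw [covDerivFwd_one_smul U₀ hη0, norm_smul, norm_pow, hnη]; ring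
    rw [e]; exact t2 ν
  · have e : ((L : ℝ) ^ j * η) ^ 3 * ‖covLap η U₀ (fun z => φ z τ) y‖ = ((L : ℝ) ^ j * 1) ^ 3 * ‖covLap 1 U₀ (fun z => ψ z τ) y‖ := by
      rw [hψ]; dsimp only
      rw [covLap_one_smul U₀ hη0, norm_smul, norm_pow, hnη]; ring
    rw [e]; exact t3

/-- ★★★ **ALL TRUNCATIONS, `InAk` FORM — `η`-UNIFORM CONSTANTS**: `∃ α₀ B″` BEFORE `∀ η > 0` in
`B8Ineq159CurvedCubeMemberInAkVerbatim.exists_curved159_perCube_inAk_verbatim_tower`. [cite: Balaban1985RegularSpaces, (1.59) p.86, (1.7)–(1.8) p.77, p.83; Balaban1985BackgroundPropagators, Thm 3.3 p.399] -/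
theorem exists_curved159_perCube_inAk_verbatim_tower_uniformEta [FiniteDimensional ℂ 𝔸] (hd2 : 2 ≤ d) {L : ℕ} (hL2 : 2 ≤ L)
    {G : Subgroup 𝔸ˣ} (hG : AvgClosed d L G) (a : Site d) (M : ℕ) {ρ : ℕ} (hρ : L ≤ ρ) {k m : ℕ} (hm1 : 1 ≤ m) (hmk : m ≤ k) :
    ∃ α₀ B'' : ℝ, 0 < α₀ ∧ 0 < B'' ∧ ∀ (η : ℝ), 0 < η → ∀ (U₀ : Site d → Fin d → 𝔸ˣ), (∀ x κ, U₀ x κ ∈ G) →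
      ∀ k' : ℕ, InAk L k' η α₀ (cubeFam false L a M ρ k) U₀ →
      ∀ φ : Site d → Fin d → 𝔸,
        IsLandau138 L m η (cubeFam false L a M ρ k 0) (cubeLamS L a M ρ k m) U₀ φ →
        (∀ (y : Site d) (τ : Fin d), (∀ j, j ≤ m → ¬ SideTouches (cubeFam false L a M ρ k j) y τ) → φ y τ = 0) →
        ∀ N : ℝ, 0 ≤ N →
          (∀ j, j ≤ m → ∀ (y : Site d) (τ : Fin d), BondTouches (cubeFam false L a M ρ k j) y τ →
              ((L : ℝ) ^ j * η) ^ 3 * ‖Jcur η U₀ φ τ y‖ ≤ N) →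
          (∀ j, j ≤ m → ∀ c ∈ cubeLamBP L a M ρ k m j, ‖linCovIter L U₀ (iEta η φ) j c.1 c.2‖ ≤ N) →
          (∀ (y : Site d) (τ : Fin d), ¬ BondTouches (cubeFam false L a M ρ k 0) y τ → η * ‖φ y τ‖ ≤ N) →
          ∀ j, j ≤ m → ∀ (y : Site d) (τ : Fin d), SideTouches (cubeFam false L a M ρ k j) y τ →
            ((L : ℝ) ^ j * η) * ‖φ y τ‖ ≤ B'' * N ∧
            (∀ ν : Fin d, ((L : ℝ) ^ j * η) ^ 2 * ‖covDerivFwd η U₀ ν (fun z => φ z τ) y‖ ≤ B'' * N) ∧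
            ((L : ℝ) ^ j * η) ^ 3 * ‖covLap η U₀ (fun z => φ z τ) y‖ ≤ B'' * N := by
  obtain ⟨α₀, B'', hα₀, hB'', H⟩ := exists_curved159_perCube_touching_tower_uniformEta (𝔸 := 𝔸) hd2 hL2 hG a M hρ hm1 hmk
  refine ⟨α₀, B'', hα₀, hB'', fun η hη U₀ hU k' hAk => H η hη U₀ hU fun z κ μ hκμ hpt => ?_⟩
  have h1 := (hAk 0 (Nat.zero_le _)).1 z κ μ hκμ hpt
  simp only [pow_zero, inv_one, one_pow, mul_one] at h1
  exact h1.le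

end Tower

section Unitary

variable {𝔹 : Type*} [CStarAlgebra 𝔹] [Nontrivial 𝔹]

/-- ★ **UNITARY C⋆ BACKGROUNDS — `η`-UNIFORM CONSTANTS** (the sockets' currency `unitaryUnits`, `InAk … i.Ω`): `∃ α₀ B″` BEFORE `∀ η > 0` in
`B8Ineq159CurvedCubeMemberInAkVerbatim.exists_curved159_perCube_inAk_verbatim_unitary`.  PER MEMBER in `(a, M, ρ, k)` — NOT the uniform [4] Thm 3.3 supply.
[cite: Balaban1985RegularSpaces, (1.59) p.86, (1.7)–(1.8) p.77; Balaban1985Averaging, (42)–(43) pp.23–24; Balaban1985BackgroundPropagators, Thm 3.3 p.399] -/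
theorem exists_curved159_perCube_inAk_verbatim_unitary_uniformEta [FiniteDimensional ℂ 𝔹] (hd2 : 2 ≤ d) {L : ℕ} (hL2 : 2 ≤ L)
    (a : Site d) (M : ℕ) {ρ : ℕ} (hρ : L ≤ ρ) {k m : ℕ} (hm1 : 1 ≤ m) (hmk : m ≤ k) :
    ∃ α₀ B'' : ℝ, 0 < α₀ ∧ 0 < B'' ∧ ∀ (η : ℝ), 0 < η → ∀ (U₀ : Site d → Fin d → 𝔹ˣ), (∀ x κ, U₀ x κ ∈ unitaryUnits 𝔹) →
      ∀ k' : ℕ, InAk L k' η α₀ (cubeFam false L a M ρ k) U₀ →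
      ∀ φ : Site d → Fin d → 𝔹,
        IsLandau138 L m η (cubeFam false L a M ρ k 0) (cubeLamS L a M ρ k m) U₀ φ →
        (∀ (y : Site d) (τ : Fin d), (∀ j, j ≤ m → ¬ SideTouches (cubeFam false L a M ρ k j) y τ) → φ y τ = 0) →
        ∀ N : ℝ, 0 ≤ N →
          (∀ j, j ≤ m → ∀ (y : Site d) (τ : Fin d), BondTouches (cubeFam false L a M ρ k j) y τ →
              ((L : ℝ) ^ j * η) ^ 3 * ‖Jcur η U₀ φ τ y‖ ≤ N) →
          (∀ j, j ≤ m → ∀ c ∈ cubeLamBP L a M ρ k m j, ‖linCovIter L U₀ (iEta η φ) j c.1 c.2‖ ≤ N) →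
          (∀ (y : Site d) (τ : Fin d), ¬ BondTouches (cubeFam false L a M ρ k 0) y τ → η * ‖φ y τ‖ ≤ N) →
          ∀ j, j ≤ m → ∀ (y : Site d) (τ : Fin d), SideTouches (cubeFam false L a M ρ k j) y τ →
            ((L : ℝ) ^ j * η) * ‖φ y τ‖ ≤ B'' * N ∧
            (∀ ν : Fin d, ((L : ℝ) ^ j * η) ^ 2 * ‖covDerivFwd η U₀ ν (fun z => φ z τ) y‖ ≤ B'' * N) ∧
            ((L : ℝ) ^ j * η) ^ 3 * ‖covLap η U₀ (fun z => φ z τ) y‖ ≤ B'' * N :=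
  exists_curved159_perCube_inAk_verbatim_tower_uniformEta (𝔸 := 𝔹) hd2 hL2 (avgClosed_unitaryUnits d L) a M hρ hm1 hmk

end Unitary

end Literature.MathematicalPhysics.QuantumFieldTheory.Balaban1983to89.B8Ineq159CurvedCubeMemberEtaScaling

end
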